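import Mathlib
import Literature.Analysis.FluidPDE.DivFreeDriftPositivityPropagationClassical
import HarnessLib

/-!
# Route `AxisTwistDoor`, crux `AveragedConeLiouville` (stmt-NavierStokesRegularity-26889), line `lrt_shell` v6, stub (5b-ii)
# `stub_axisHarnackChainA` — brick B2/B3: the ABSTRACT HARNACK CHAIN (propagation of positivity along linked cylinders)

Lei–Ren–Tian (arXiv:2501.08976, §4 pp. 11–12) propagate a lower bound for the comparison function `V = M − Γ̂` from a
neighbourhood of the axis at early times, across the region `𝒟₁` and then along the lateral shell `𝒟₂` up to the apex
time, by a CHAIN of applications of the Nazarov–Ural'tseva positivity-propagation lemma on overlapping parabolic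
cylinders.  This file isolates the chain as a statement of pure bookkeeping, with the positivity-propagation property
ON ARBITRARY CYLINDERS taken as a HYPOTHESIS `hcyl` (literally the consequent of ns-cas-k2's
`PositivityCylinders.factC_on_cylinder`, i.e. the line's `PositivityPropagationAffine`):

* `chain_positivity` — there is `β ∈ (0,1]`, depending only on `hcyl`, the time-shape `T` and the drift constant `Λ`,
  such that for every classical supersolution `V ≥ 0` of `∂ₜV − ΔV + b·∇V ≥ 0` (drift `|b| ≤ Λ/ρ`, `div b = 0`) on a
  chain of `N+1` cylinders `[t_k, t_k + ρ²T] × B̄(x_k, ρ)`, `t_k = t₀ + k·ρ²T/2`, consecutive centres at distance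
  `≤ ρ/2`, all inside the open set `U` where `V ∈ C²`, `b ∈ C¹`: if `V ≥ λ > 0` on `B(x₀, ρ)` at the time `t₀ + ρ²T/4`,
  then `V ≥ β^{k+1} λ` on `(t_k + ρ²T/2, t_k + ρ²T) × B(x_k, ρ/2)` for every `k ≤ N`.

Mechanism: induction on `k`; the conclusion ball `B(x_k, ρ/2)` at the time `t_{k+1} + ρ²T/4 = t_k + 3ρ²T/4` lies in the
next ball `B(x_{k+1}, ρ)` and has volume `(π/6) ρ³` (`EuclideanSpace.volume_ball_fin_three`), which is the density
hypothesis of the next cylinder with `δ = π/6`, `r = 1/2`.  Width seat ns-in-wu-341 g2 under LEAD ns-atd-p1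
(card `Cruxes/AveragedConeLiouville/Lines/lrt_shell.md` §Chain plan, steps 3–5 made uniform).
[cite: LeiRenTian2025, §4 (arXiv:2501.08976, pp. 11–12); NazarovUraltseva2011HarnackDivFree, Cor. 3.2]

WHAT THIS IS NOT: not a statement about Navier–Stokes regularity; parabolic bookkeeping for a STAGED door route; the
positivity-propagation property itself is a HYPOTHESIS here (ultimately the NAMED Nazarov–Ural'tseva fact).
-/

noncomputable section

-- the summit and its single sub-problem share the name (CONVENTIONS §1)
set_option linter.dupNamespace false

namespace Summit.NavierStokesRegularity.NavierStokesRegularity.Theorems.AveragedConeLiouville.HarnackChainCore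

open scoped InnerProductSpace Laplacian ENNReal
open Set Metric MeasureTheory
open Literature.Analysis.FluidPDE

/-- The volume of a ball of radius `ρ/2` in `ℝ³` is `(π/6) ρ³`. [folklore] -/
theorem volume_ball_half (y : EuclideanSpace ℝ (Fin 3)) {ρ : ℝ} (hρ : 0 ≤ ρ) :
    volume (ball y (ρ / 2)) = ENNReal.ofReal (Real.pi / 6 * ρ ^ 3) := by
  rw [EuclideanSpace.volume_ball_fin_three, ← ENNReal.ofReal_pow (by positivity), ← ENNReal.ofReal_mul (by positivity)]
  congr 1
  ring

/-- **The abstract Harnack chain** (module docstring): positivity propagates along a chain of linked parabolic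
cylinders with the factor `β` per link, `β ∈ (0,1]` depending only on the cylinder property `hcyl`, the time-shape `T`
and the drift constant `Λ`. [cite: LeiRenTian2025, §4 (arXiv:2501.08976, pp. 11–12)] -/
theorem chain_positivity
    (hcyl : ∀ δ T r Λ : ℝ, 0 < δ → 0 < T → 0 < r → r < 1 → 0 ≤ Λ → ∃ β : ℝ, 0 < β ∧
      ∀ (V : ℝ → EuclideanSpace ℝ (Fin 3) → ℝ) (b : ℝ → EuclideanSpace ℝ (Fin 3) → EuclideanSpace ℝ (Fin 3))
        (U : Set (ℝ × EuclideanSpace ℝ (Fin 3))) (x₀ : EuclideanSpace ℝ (Fin 3)) (t₀ ρ : ℝ), 0 < ρ → IsOpen U →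
        Set.Icc t₀ (t₀ + ρ ^ 2 * T) ×ˢ Metric.closedBall x₀ ρ ⊆ U →
        ContDiffOn ℝ 2 (Function.uncurry V) U → ContDiffOn ℝ 1 (Function.uncurry b) U →
        (∀ t ∈ Set.Ioo t₀ (t₀ + ρ ^ 2 * T), ∀ x ∈ Metric.ball x₀ ρ, ‖b t x‖ ≤ Λ / ρ) →
        (∀ t ∈ Set.Ioo t₀ (t₀ + ρ ^ 2 * T), ∀ x ∈ Metric.ball x₀ ρ, VectorCalculus.divergence (b t) x = 0) →
        (∀ t ∈ Set.Ioo t₀ (t₀ + ρ ^ 2 * T), ∀ x ∈ Metric.ball x₀ ρ, 0 ≤ V t x) →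
        (∀ t ∈ Set.Ioo t₀ (t₀ + ρ ^ 2 * T), ∀ x ∈ Metric.ball x₀ ρ,
            0 ≤ deriv (fun τ => V τ x) t - (Δ (V t)) x + ⟪b t x, gradient (V t) x⟫_ℝ) →
        ∀ tbar lam : ℝ, t₀ < tbar → tbar < t₀ + ρ ^ 2 * T / 3 → 0 < lam →
          ENNReal.ofReal (δ * ρ ^ 3) ≤
            volume {x : EuclideanSpace ℝ (Fin 3) | x ∈ Metric.ball x₀ ρ ∧ lam ≤ V tbar x} →
          ∀ t ∈ Set.Ioo (t₀ + ρ ^ 2 * T / 2) (t₀ + ρ ^ 2 * T), ∀ x ∈ Metric.ball x₀ (r * ρ), β * lam ≤ V t x)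
    {T Λ : ℝ} (hT : 0 < T) (hΛ : 0 ≤ Λ) :
    ∃ β : ℝ, 0 < β ∧ β ≤ 1 ∧
      ∀ (V : ℝ → EuclideanSpace ℝ (Fin 3) → ℝ) (b : ℝ → EuclideanSpace ℝ (Fin 3) → EuclideanSpace ℝ (Fin 3))
        (U : Set (ℝ × EuclideanSpace ℝ (Fin 3))) (x : ℕ → EuclideanSpace ℝ (Fin 3)) (t₀ ρ lam : ℝ) (N : ℕ),
        0 < ρ → 0 < lam → IsOpen U → ContDiffOn ℝ 2 (Function.uncurry V) U → ContDiffOn ℝ 1 (Function.uncurry b) U →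
        (∀ k : ℕ, k < N → dist (x (k + 1)) (x k) ≤ ρ / 2) →
        (∀ k : ℕ, k ≤ N →
          Set.Icc (t₀ + k * (ρ ^ 2 * T / 2)) (t₀ + k * (ρ ^ 2 * T / 2) + ρ ^ 2 * T) ×ˢ Metric.closedBall (x k) ρ ⊆ U) →
        (∀ k : ℕ, k ≤ N → ∀ t ∈ Set.Ioo (t₀ + k * (ρ ^ 2 * T / 2)) (t₀ + k * (ρ ^ 2 * T / 2) + ρ ^ 2 * T),
          ∀ y ∈ Metric.ball (x k) ρ,
            ‖b t y‖ ≤ Λ / ρ ∧ VectorCalculus.divergence (b t) y = 0 ∧ 0 ≤ V t y ∧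
              0 ≤ deriv (fun τ => V τ y) t - (Δ (V t)) y + ⟪b t y, gradient (V t) y⟫_ℝ) →
        (∀ y ∈ Metric.ball (x 0) ρ, lam ≤ V (t₀ + ρ ^ 2 * T / 4) y) →
        ∀ k : ℕ, k ≤ N →
          ∀ t ∈ Set.Ioo (t₀ + k * (ρ ^ 2 * T / 2) + ρ ^ 2 * T / 2) (t₀ + k * (ρ ^ 2 * T / 2) + ρ ^ 2 * T),
            ∀ y ∈ Metric.ball (x k) (ρ / 2), β ^ (k + 1) * lam ≤ V t y := by
  obtain ⟨β, hβ, H⟩ := hcyl (Real.pi / 6) T (1 / 2) Λ (by positivity) hT (by norm_num) (by norm_num) hΛ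
  refine ⟨min β 1, lt_min hβ one_pos, min_le_right _ _, ?_⟩
  intro V b U x t₀ ρ lam N hρ hlam hU hV hb hdist hsubU hdata h0
  have hβ1 : 0 < min β 1 := lt_min hβ one_pos
  have hβle : min β 1 ≤ β := min_le_left _ _
  -- one application of the cylinder property on the `k`-th cylinder
  have happly : ∀ k : ℕ, k ≤ N → ∀ lam' : ℝ, 0 < lam' →
      ENNReal.ofReal (Real.pi / 6 * ρ ^ 3) ≤
          volume {x' : EuclideanSpace ℝ (Fin 3) | x' ∈ Metric.ball (x k) ρ ∧
            lam' ≤ V (t₀ + k * (ρ ^ 2 * T / 2) + ρ ^ 2 * T / 4) x'} →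
      ∀ t ∈ Set.Ioo (t₀ + k * (ρ ^ 2 * T / 2) + ρ ^ 2 * T / 2) (t₀ + k * (ρ ^ 2 * T / 2) + ρ ^ 2 * T),
        ∀ y ∈ Metric.ball (x k) (ρ / 2), β * lam' ≤ V t y := by
    intro k hk lam' hlam' hvol t ht y hy
    have hρT : 0 < ρ ^ 2 * T := by positivity
    have h := H V b U (x k) (t₀ + k * (ρ ^ 2 * T / 2)) ρ hρ hU (hsubU k hk) hV hb
      (fun t ht y hy => (hdata k hk t ht y hy).1) (fun t ht y hy => (hdata k hk t ht y hy).2.1)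
      (fun t ht y hy => (hdata k hk t ht y hy).2.2.1) (fun t ht y hy => (hdata k hk t ht y hy).2.2.2)
      (t₀ + k * (ρ ^ 2 * T / 2) + ρ ^ 2 * T / 4) lam' (by linarith) (by linarith) hlam' hvol t ht y
      (by rw [show (1 : ℝ) / 2 * ρ = ρ / 2 by ring]; exact hy)
    exact h
  -- the induction
  intro k
  induction k with
  | zero =>
    intro _ t ht y hy
    have hvol : ENNReal.ofReal (Real.pi / 6 * ρ ^ 3) ≤
        volume {x' : EuclideanSpace ℝ (Fin 3) | x' ∈ Metric.ball (x 0) ρ ∧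
          lam ≤ V (t₀ + (0 : ℕ) * (ρ ^ 2 * T / 2) + ρ ^ 2 * T / 4) x'} := by
      rw [← volume_ball_half (x 0) hρ.le]
      refine measure_mono fun y hy => ?_
      have hy' : y ∈ Metric.ball (x 0) ρ := ball_subset_ball (by linarith) hy
      refine ⟨hy', ?_⟩
      simpa using h0 y hy'
    have h := happly 0 (Nat.zero_le _) lam hlam hvol t ht y hy
    calc (min β 1) ^ (0 + 1) * lam = min β 1 * lam := by ring
      _ ≤ β * lam := mul_le_mul_of_nonneg_right hβle hlam.le
      _ ≤ V t y := h
  | succ k ih =>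
    intro hk t ht y hy
    have hk' : k ≤ N := Nat.le_of_succ_le hk
    have hklt : k < N := Nat.lt_of_succ_le hk
    set lam' : ℝ := (min β 1) ^ (k + 1) * lam with hlam'def
    have hlam' : 0 < lam' := by positivity
    -- the density hypothesis of the `(k+1)`-st cylinder from the conclusion on the `k`-th
    have htbar : t₀ + ((k + 1 : ℕ) : ℝ) * (ρ ^ 2 * T / 2) + ρ ^ 2 * T / 4 ∈
        Set.Ioo (t₀ + k * (ρ ^ 2 * T / 2) + ρ ^ 2 * T / 2) (t₀ + k * (ρ ^ 2 * T / 2) + ρ ^ 2 * T) := by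
      have hρT : 0 < ρ ^ 2 * T := by positivity
      constructor <;> · push_cast; nlinarith
    have hvol : ENNReal.ofReal (Real.pi / 6 * ρ ^ 3) ≤
        volume {x' : EuclideanSpace ℝ (Fin 3) | x' ∈ Metric.ball (x (k + 1)) ρ ∧
          lam' ≤ V (t₀ + ((k + 1 : ℕ) : ℝ) * (ρ ^ 2 * T / 2) + ρ ^ 2 * T / 4) x'} := by
      rw [← volume_ball_half (x k) hρ.le]
      refine measure_mono fun y hy => ?_
      have hyk : y ∈ Metric.ball (x (k + 1)) ρ := by
        rw [Metric.mem_ball] at hy ⊢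
        calc dist y (x (k + 1)) ≤ dist y (x k) + dist (x k) (x (k + 1)) := dist_triangle _ _ _
          _ < ρ / 2 + ρ / 2 := by
              have h2 : dist (x k) (x (k + 1)) ≤ ρ / 2 := by rw [dist_comm]; exact hdist k hklt
              linarith
          _ = ρ := by ring
      exact ⟨hyk, ih hk' _ htbar y hy⟩
    have h := happly (k + 1) hk lam' hlam' hvol t ht y hy
    calc (min β 1) ^ (k + 1 + 1) * lam = min β 1 * lam' := by rw [hlam'def]; ring
      _ ≤ β * lam' := mul_le_mul_of_nonneg_right hβle hlam'.le
      _ ≤ V t y := h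

end Summit.NavierStokesRegularity.NavierStokesRegularity.Theorems.AveragedConeLiouville.HarnackChainCore

end
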